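/-
Copyright (c) 2026 the pub-hodgecm-mathlib formalisation cell (harness21).  Prover seat hodgecm-mathlib-LH4-p14 (g6), req620 Track A «(D-RAM) FOUR-FRAME» squad, helper lane
on h413 = stmt-HodgeConjecture-24833 (count-neutral).  STAGE-1b ARITHMETIC brick (V7) — the token hypothesis `hA` of ★ p859212 ∕ ★ p859064 (V2) DISCHARGED for every
SHIFTED-AMPLITUDE token `A q d t k B = ampl q (k − ks) (B − bs)` (the TEMPLATE family of F0P3-p01 (g35): sq, lev, shell halves), given `Ω = 1` on the row data.  2026-09-04.
-/
import Summits.HodgeConjecture.HodgeConjecture.Theorems.F0P3cDyRamFourFrameLawDefsR2     -- ★ №1-R2: `OmegaSchedule` (brings ★ #0a `ampl`, `IsElementDatum`)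
import Summits.HodgeConjecture.HodgeConjecture.Theorems.F0P3cDyRamFourFrameHSideDefsR    -- ★ №2c-R: the place vocabulary (`UnitaryGroup.PlacesOver`, `galAdicCompletionMap`)
import Summits.HodgeConjecture.HodgeConjecture.Theorems.F0P3cDyRamPieceRowOneAffineCoef   -- ★ p859212 (V2′): `hSideIdentity_hFamily_coefAffine_of_affine_token` (§3 composes with it)
import HarnessLib

/-!
# Crux `H413`, line LH4 «(D-RAM) FOUR-FRAME» — (V7) THE COLLAPSED SHIFTED AMPLITUDE IS AFFINE IN THE EDGE-BALL COUNT: `q^{−m}·ampl(q, k − ks, B − bs) = 2q^{−ks}·V(n₃) + 4(q^{−ks} − q^{S−ks+bs})∕(q − 1)`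

Cell `hodgecm-mathlib` (D-0151), FLOOR 0, crux item H413 = `stmt-HodgeConjecture-24833`, route `HCCMUnconditional`; squad F0∕P3c∕LH4.  THEOREMS ONLY (no `def`, no instance, no
notation, no `sorry`, default heartbeats); ★ `Theorems`∕`Literature` imports only; lane `--supports stmt-HodgeConjecture-24833 --as helper`; COUNT-NEUTRAL (pure arithmetic + one
bookkeeping wrapper whose inputs `hAmp` (the token's letters) and `hΩ` (the sign schedule is `1` on the row data — the covered-cell fact of record) are HYPOTHESES).

WHY.  ★ p859212 `hSideIdentity_hFamily_coefAffine_of_affine_token` (and ★ p859064 (V2)) turn ROW (1) of any STAGE-1b piece into ONE arithmetic hypothesis `hA` on its κ-law token: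
on the row data the collapsed amplitude `C·q_w^{−(n₁+n₂)∕2}·(Ω·A(q_w, d, t_E, k, B))` is affine `cA·V(n₃) + cB` in ★ (ρ1a)'s edge-ball count `V(N) = 2(q^{(N−d)∕2+1} − 1)∕(q − 1)`.  Every
token of the TEMPLATE family (F0P3-p01 (g35) TEMPLATE-LAWS; (L-sq) `ampl q (k − cs d) (B − cs d)`, (L-lev) `ampl q (k − kl d) (B − bl d)`, the T₊ half-difference) is a SHIFTED unit
amplitude `ampl q (k − ks) (B − bs)`.  This file discharges `hA` for all of them at once:
* §1 `inv_pow_mul_ampl_shift_eq` (pure ℚ): with `j = k − m`, `B = j − S`, `bs ≤ B`, `ks ≤ k`, `n + 1 = j`: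
  `(q^m)⁻¹ · ampl q (k − ks) (B − bs) = 2·q^{−ks}·(2(q^{n+1} − 1)∕(q − 1)) + 4·(q^{−ks} − q^{S−ks+bs})∕(q − 1)` (★ `inv_pow_mul_ampl_eq` is the case `ks = bs = 0` before the affine split).
* §3 `hSideIdentity_hFamily_of_amplShift` — ★ p859212 ∘ §2: the sign-free row-(1) identity for `hFamily` at those letters (the END a template piece's row (1) needs).
* §2 `affine_token_of_amplShift` — the `hA` of ★ p859212 VERBATIM (its binder text), at `cA := C·2·q_w^{−ks}`, `cB := C·4·(q_w^{−ks} − q_w^{shift d t_E − ks + bs})∕(q_w − 1)`,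
  `N₁ := d + 2·(ks + bs) + 2·|shift d t_E|`, from `hAmp : ∀ q k B, A q d t_E k B = ampl q (k − ks) (B − bs)` and `hΩ : Ω = 1` on the element data (slot 2).  The row relations give
  `m = (n₁+n₂)∕2`, `j = (n₃ + 2 − d)∕2`, `B = j − shift d t_E`, `n = (n₃ − d)∕2`, and the floor `N₁` makes `ks ≤ k`, `bs ≤ B` (the `max 0` corner of `ampl` inactive).
So: ROW (1) of every template piece for `ψ := hFamily` is ★ modulo its LAW and `Ω = 1` on the cells it serves — `coefAffine(C·2q^{−ks}, C·4(q^{−ks} − q^{S−ks+bs})∕(q−1))` are its letters,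
and by ★ p859233∕p859252 its Levi row reads `cA∕2 = C·q^{−ks}` against the fibre volume («𝒜 = ρ»: `ρ = q^{−ks}`).
HONEST LABEL.  Count-neutral; pays no registered stub, touches no `Lines/` module, asserts no law; `HC_CM` is proved only modulo the 7 printed citations (2 remaining named inputs:
hLiu418 = `stmt-HodgeConjecture-24832`, h413 = `stmt-HodgeConjecture-24833`) until rung 0 closes.

## References
* [Rogawski1990] J. D. Rogawski, *Automorphic Representations of Unitary Groups in Three Variables*, Ann. of Math. Stud. 123 (1990): §4.9 Prop. 4.9.1 (a)(b) p. 55, Lemma 4.9.3 (4.9.2) p. 56.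
* [LabesseLanglands1979] J.-P. Labesse, R. P. Langlands, *L-indistinguishability for SL(2)*, Canad. J. Math. 31 (1979), §2 (2.1)–(2.2) (edge-ball counts).
-/

set_option autoImplicit false

noncomputable section

namespace Summit.HodgeConjecture.HodgeConjecture.Cruxes.H413.F0P3cDyRamAmplShiftAffine

open NumberField IsDedekindDomain
open Literature.NumberTheory.Automorphic Literature.NumberTheory.Automorphic.UnitaryGroup Literature.NumberTheory.GaloisRepresentations
open Literature.NumberTheory.Automorphic.UnitaryThreeFourFrame
open Summit.HodgeConjecture.HodgeConjecture.Cruxes.H413.F0P3cDyRamFourFrameLawDefsR2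
open scoped Matrix MatrixGroups Classical ValuativeRel WithZero
open MeasureTheory Measure Topology Filter Literature.NumberTheory.Automorphic.IntegralReduction Literature.NumberTheory.Rogawski1990
open Summit.HodgeConjecture.HodgeConjecture.Cruxes.H413.F0P3cDyRamPieceRowOneAffineCoef Summit.HodgeConjecture.HodgeConjecture.Cruxes.H413.F0P3cDyRamFourFrameHFamilyDefs
open Literature.NumberTheory.Automorphic.UnitaryLatticeTree Literature.NumberTheory.Automorphic.HermitianLattice

/-! ## §1  The arithmetic -/

/-- **`(q^m)⁻¹ · ampl q (k − ks) (B − bs) = 2q^{−ks}·V + 4(q^{−ks} − q^{S−ks+bs})∕(q − 1)`** with `V = 2(q^{n+1} − 1)∕(q − 1)`, `n + 1 = j = k − m`, `B = j − S`, off the `max 0`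
corner (`bs ≤ B`) and with honest ℕ-subtraction (`ks ≤ k`).  [cite: Rogawski1990, §4.9 Lemma 4.9.3 (4.9.2) p. 56] [cite: LabesseLanglands1979, §2 (2.2)] -/
theorem inv_pow_mul_ampl_shift_eq (q : ℕ) (hq : 1 < q) (m k ks : ℕ) (hks : ks ≤ k) (B S j : ℤ) (bs : ℕ)
    (hj : j = (k : ℤ) - m) (hB : B = j - S) (hbs : (bs : ℤ) ≤ B) (n : ℕ) (hn : (n : ℤ) + 1 = j) :
    ((q : ℚ) ^ m)⁻¹ * ampl q (k - ks) (B - bs) =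
      2 * (q : ℚ) ^ (-(ks : ℤ)) * (2 * ((q : ℚ) ^ (n + 1) - 1) / ((q : ℚ) - 1)) +
        4 * ((q : ℚ) ^ (-(ks : ℤ)) - (q : ℚ) ^ (S - ks + bs)) / ((q : ℚ) - 1) := by
  have hq0 : (q : ℚ) ≠ 0 := by exact_mod_cast (show q ≠ 0 by omega)
  have hq1 : (1 : ℚ) ≤ q := by exact_mod_cast hq.le
  -- off the corner: the `max 0` is inactive
  have hle : (q : ℚ) ^ (((k - ks : ℕ) : ℤ) - (B - bs)) ≤ (q : ℚ) ^ ((k - ks : ℕ) : ℤ) :=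
    zpow_le_zpow_right₀ hq1 (by omega)
  have hmax : max 0 ((q : ℚ) ^ ((k - ks : ℕ) : ℤ) - (q : ℚ) ^ (((k - ks : ℕ) : ℤ) - (B - bs))) =
      (q : ℚ) ^ ((k - ks : ℕ) : ℤ) - (q : ℚ) ^ (((k - ks : ℕ) : ℤ) - (B - bs)) := max_eq_right (sub_nonneg.2 hle)
  -- the two exponent identities
  have hks' : ((k - ks : ℕ) : ℤ) = (k : ℤ) - ks := by push_cast [Nat.cast_sub hks]; ring
  have e1 : ((q : ℚ) ^ m)⁻¹ * (q : ℚ) ^ ((k - ks : ℕ) : ℤ) = (q : ℚ) ^ (-(ks : ℤ)) * (q : ℚ) ^ (n + 1) := by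
    rw [← zpow_natCast (q : ℚ) m, ← zpow_neg, ← zpow_add₀ hq0, ← zpow_natCast (q : ℚ) (n + 1), ← zpow_add₀ hq0]
    congr 1; push_cast; omega
  have e2 : ((q : ℚ) ^ m)⁻¹ * (q : ℚ) ^ (((k - ks : ℕ) : ℤ) - (B - bs)) = (q : ℚ) ^ (S - ks + bs) := by
    rw [← zpow_natCast (q : ℚ) m, ← zpow_neg, ← zpow_add₀ hq0]
    congr 1; omega
  unfold ampl
  rw [hmax, show ((q : ℚ) ^ m)⁻¹ * (4 * ((q : ℚ) ^ ((k - ks : ℕ) : ℤ) - (q : ℚ) ^ (((k - ks : ℕ) : ℤ) - (B - bs))) / ((q : ℚ) - 1)) =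
      4 * (((q : ℚ) ^ m)⁻¹ * (q : ℚ) ^ ((k - ks : ℕ) : ℤ) - ((q : ℚ) ^ m)⁻¹ * (q : ℚ) ^ (((k - ks : ℕ) : ℤ) - (B - bs))) / ((q : ℚ) - 1) by ring,
    e1, e2]
  ring

/-! ## §2  The `hA` of ★ p859212 for a shifted-amplitude token -/

/-- **(V7) `affine_token_of_amplShift`** — the hypothesis `hA` of ★ p859212 `hSideIdentity_hFamily_coefAffine_of_affine_token` (equivalently of ★ p859064 (V2)), VERBATIM, for a
token of the shape `A q d t_E k B = ampl q (k − ks) (B − bs)` (`hAmp`; `ks bs : ℕ` the piece's exponent shifts at this datum) and a sign schedule that is `1` on the slot-`2` element data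
(`hΩ` — the covered-cell fact of record), at the LETTERS `cA := C·2·q_w^{−ks}`, `cB := C·4·(q_w^{−ks} − q_w^{shift d t_E − ks + bs})∕(q_w − 1)`, floor `N₁ := d + 2(ks + bs) + 2|shift d t_E|`.
[cite: Rogawski1990, §4.9 Prop. 4.9.1 (b) p. 55, Lemma 4.9.3 (4.9.2) p. 56] [cite: LabesseLanglands1979, §2 (2.2)] -/
theorem affine_token_of_amplShift (shift : ℕ → ℕ → ℤ) (Ω : OmegaSchedule) (N₀ : ℕ → ℕ) (A : ℕ → ℕ → ℕ → ℕ → ℤ → ℚ)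
    (L : Type) [Field L] [NumberField L] [IsCMField L]
    {v : HeightOneSpectrum (𝓞 ↥(maximalRealSubfield L))} (w : UnitaryGroup.PlacesOver L v)
    (hw : IsCMField.complexConj L • w.1 = w.1) (ϖ : (w.1.adicCompletion L)) (d tE : ℕ)
    [Fintype (Valued.ResidueField (w.1.adicCompletion L))] (C : ℂ) (ks bs : ℕ)
    (hAmp : ∀ (q k : ℕ) (B : ℤ), A q d tE k B = ampl q (k - ks) (B - bs))
    (hΩ : ∀ (a b : (w.1.adicCompletion L)) (n₁ n₂ n₃ : ℕ),
      a * (galAdicCompletionMap (L := L) (IsCMField.complexConj L) hw) a = 1 → b * (galAdicCompletionMap (L := L) (IsCMField.complexConj L) hw) b = 1 →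
      IsElementDatum (galAdicCompletionMap (L := L) (IsCMField.complexConj L) hw) ϖ (N₀ d) (a * a) (b * b) n₁ n₂ n₃ →
      Ω (w.1.adicCompletion L) (galAdicCompletionMap (L := L) (IsCMField.complexConj L) hw) ϖ d a b 2 = 1) :
    ∀ (a b : (w.1.adicCompletion L)) (n₁ n₂ n₃ k : ℕ) (i : Fin 3) (B : ℤ),
        a * (galAdicCompletionMap (L := L) (IsCMField.complexConj L) hw) a = 1 → b * (galAdicCompletionMap (L := L) (IsCMField.complexConj L) hw) b = 1 →
        IsElementDatum (galAdicCompletionMap (L := L) (IsCMField.complexConj L) hw) ϖ (N₀ d) (a * a) (b * b) n₁ n₂ n₃ →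
        2 * ((n₁ + n₂) / 2) = n₁ + n₂ → 2 * k + d = n₁ + n₂ + n₃ + 2 → 2 * B = ((![n₁, n₂, n₃] : Fin 3 → ℕ) i : ℤ) - d + 2 - 2 * shift d tE → i = 2 →
        d + 2 * (ks + bs) + 2 * (shift d tE).natAbs ≤ n₃ → (n₃ + d) % 2 = 0 →
        C * ((Fintype.card (Valued.ResidueField (w.1.adicCompletion L)) : ℂ) ^ ((n₁ + n₂) / 2))⁻¹ * (((Ω (w.1.adicCompletion L) (galAdicCompletionMap (L := L) (IsCMField.complexConj L) hw) ϖ d a b i : ℤ) : ℂ) * ((A (Fintype.card (Valued.ResidueField (w.1.adicCompletion L))) d tE k B : ℚ) : ℂ)) =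
          (C * ((2 * (Fintype.card (Valued.ResidueField (w.1.adicCompletion L)) : ℚ) ^ (-(ks : ℤ)) : ℚ) : ℂ)) *
              (((2 * ((Fintype.card (Valued.ResidueField (w.1.adicCompletion L)) : ℚ) ^ (((n₃ - d) / 2 : ℕ) + 1) - 1) / ((Fintype.card (Valued.ResidueField (w.1.adicCompletion L)) : ℚ) - 1) : ℚ)) : ℂ) +
            C * ((4 * ((Fintype.card (Valued.ResidueField (w.1.adicCompletion L)) : ℚ) ^ (-(ks : ℤ)) -
                  (Fintype.card (Valued.ResidueField (w.1.adicCompletion L)) : ℚ) ^ (shift d tE - ks + bs)) / ((Fintype.card (Valued.ResidueField (w.1.adicCompletion L)) : ℚ) - 1) : ℚ) : ℂ) := by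
  intro a b n₁ n₂ n₃ k i B ha hb hE hev hk hB hi hN₁ hpar
  subst hi
  have hB' : 2 * B = (n₃ : ℤ) - d + 2 - 2 * shift d tE := by simpa using hB
  -- the row relations: `j = k − m = (n₃ + 2 − d)∕2`, `B = j − S`, `n = (n₃ − d)∕2`
  have hk' : 2 * (k : ℤ) + d = (n₁ : ℤ) + n₂ + n₃ + 2 := by exact_mod_cast hk
  have hev' : 2 * (((n₁ + n₂) / 2 : ℕ) : ℤ) = (n₁ : ℤ) + n₂ := by exact_mod_cast hev
  have hSabs := Int.le_natAbs (a := shift d tE)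
  have hSabs' : -shift d tE ≤ ((shift d tE).natAbs : ℤ) := by
    have h := Int.le_natAbs (a := -shift d tE); rwa [Int.natAbs_neg] at h
  have hdn : d ≤ n₃ := by omega
  have hnn : 2 * (((n₃ - d) / 2 : ℕ) : ℤ) = (n₃ : ℤ) - d := by
    have h2 : 2 * ((n₃ - d) / 2) = n₃ - d := by omega
    have h3 : (((n₃ - d : ℕ) : ℤ)) = (n₃ : ℤ) - d := Nat.cast_sub hdn
    rw [← h3]; exact_mod_cast h2
  have hks : ks ≤ k := by omega
  have hbs : (bs : ℤ) ≤ B := by omega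
  have hq : 1 < Fintype.card (Valued.ResidueField (w.1.adicCompletion L)) := Fintype.one_lt_card
  have key := inv_pow_mul_ampl_shift_eq (Fintype.card (Valued.ResidueField (w.1.adicCompletion L))) hq ((n₁ + n₂) / 2) k ks hks B (shift d tE)
    ((k : ℤ) - ((n₁ + n₂) / 2 : ℕ)) bs rfl (by omega) hbs ((n₃ - d) / 2) (by omega)
  have keyC := congrArg (fun x : ℚ => (x : ℂ)) key
  rw [hΩ a b n₁ n₂ n₃ ha hb hE, hAmp, Int.cast_one, one_mul]
  push_cast at keyC ⊢
  rw [mul_assoc, keyC]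
  ring

/-! ## §3  The sign-free row-(1) identity of a shifted-amplitude piece, letters explicit (★ p859212 ∘ §2) -/

/-- **(V7′) `hSideIdentity_hFamily_of_amplShift` — ROW (1)'s SIGN-FREE H-SIDE IDENTITY FOR `hFamily`, FOR ANY SHIFTED-AMPLITUDE TOKEN, LETTERS EXPLICIT.**  ★ p859212's
conclusion (the `hH` of ★ p859064 (V1) for `ψ := hFamily`) at `coef := coefAffine(C·2·q_w^{−ks}, C·4·(q_w^{−ks} − q_w^{S−ks+bs})∕(q_w − 1))`, `S = shift d t_E`, from `hAmp`
(`A q d t_E k B = ampl q (k − ks) (B − bs)`) and `hΩ` (`Ω = 1` on the slot-2 element data) — i.e. for the TEMPLATE pieces (sq: `ks = bs = cs d`; lev: `(kl d, bl d)`; F0P3-p01 (g35))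
ROW (1) is ★ modulo the LAW and the covered-cell sign fact, with NO coefficient left to fit; its Levi check (★ p859233∕p859252) then reads `C·q_w^{−ks}` against the fibre volume.
[cite: Rogawski1990, §4.9 Prop. 4.9.1 (b) p. 55, Lemma 4.9.3 (4.9.2) p. 56] [cite: LabesseLanglands1979, §2 (2.2)] -/
theorem hSideIdentity_hFamily_of_amplShift (shift : ℕ → ℕ → ℤ) (Ω : OmegaSchedule) (N₀ : ℕ → ℕ) (A : ℕ → ℕ → ℕ → ℕ → ℤ → ℚ)
    (L : Type) [Field L] [NumberField L] [IsCMField L]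
      {v : HeightOneSpectrum (𝓞 ↥(maximalRealSubfield L))} (w : UnitaryGroup.PlacesOver L v)
      (hw : IsCMField.complexConj L • w.1 = w.1) (_he : v.asIdeal.ramificationIdx' w.1.asIdeal ≠ 1)
      (_h2 : ¬ IsUnit (2 : 𝒪[w.1.adicCompletion L]))
      (ϖ : (w.1.adicCompletion L)) (_hϖ : Valued.v ϖ = WithZero.exp (-1 : ℤ)) (d tE : ℕ) (_hD : IsRamifiedQuadraticDatum (galAdicCompletionMap (L := L) (IsCMField.complexConj L) hw) ϖ d tE)
      [Fintype (Valued.ResidueField (w.1.adicCompletion L))] (δ : (w.1.adicCompletion L)) (_hδ : (galAdicCompletionMap (L := L) (IsCMField.complexConj L) hw) δ = -δ) (_hδ0 : δ ≠ 0)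
      (μ : HeckeCharacter L) (_hμu : μ.IsUnitary)
      (_hμω : ∀ x : ideleGroup ↥(maximalRealSubfield L), μ (AdeleRing.ideleBaseChange ↥(maximalRealSubfield L) L x) = quadraticHeckeCharCM L x)
      [MeasurableSpace ((UnitaryGroup.cmDatum L 3 (Matrix.of fun i j : Fin 3 => if i.val + j.val + 1 = 3 then (1 : L) else 0)).Local v)] [BorelSpace ((UnitaryGroup.cmDatum L 3 (Matrix.of fun i j : Fin 3 => if i.val + j.val + 1 = 3 then (1 : L) else 0)).Local v)]
      [∀ γ : ((UnitaryGroup.cmDatum L 3 (Matrix.of fun i j : Fin 3 => if i.val + j.val + 1 = 3 then (1 : L) else 0)).Local v), MeasurableSpace (((UnitaryGroup.cmDatum L 3 (Matrix.of fun i j : Fin 3 => if i.val + j.val + 1 = 3 then (1 : L) else 0)).Local v) ⧸ Subgroup.centralizer ({γ} : Set ((UnitaryGroup.cmDatum L 3 (Matrix.of fun i j : Fin 3 => if i.val + j.val + 1 = 3 then (1 : L) else 0)).Local v)))]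
      [∀ γ : ((UnitaryGroup.cmDatum L 3 (Matrix.of fun i j : Fin 3 => if i.val + j.val + 1 = 3 then (1 : L) else 0)).Local v), BorelSpace (((UnitaryGroup.cmDatum L 3 (Matrix.of fun i j : Fin 3 => if i.val + j.val + 1 = 3 then (1 : L) else 0)).Local v) ⧸ Subgroup.centralizer ({γ} : Set ((UnitaryGroup.cmDatum L 3 (Matrix.of fun i j : Fin 3 => if i.val + j.val + 1 = 3 then (1 : L) else 0)).Local v)))]
      [MeasurableSpace ((UnitaryGroup.cmDatum L 2 (Matrix.of fun i j : Fin 2 => if i.val + j.val + 1 = 2 then (1 : L) else 0)).Local v × (UnitaryGroup.cmDatum L 1 (Matrix.of fun i j : Fin 1 => if i.val + j.val + 1 = 1 then (1 : L) else 0)).Local v)] [BorelSpace ((UnitaryGroup.cmDatum L 2 (Matrix.of fun i j : Fin 2 => if i.val + j.val + 1 = 2 then (1 : L) else 0)).Local v × (UnitaryGroup.cmDatum L 1 (Matrix.of fun i j : Fin 1 => if i.val + j.val + 1 = 1 then (1 : L) else 0)).Local v)]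
      [∀ a : ((UnitaryGroup.cmDatum L 2 (Matrix.of fun i j : Fin 2 => if i.val + j.val + 1 = 2 then (1 : L) else 0)).Local v × (UnitaryGroup.cmDatum L 1 (Matrix.of fun i j : Fin 1 => if i.val + j.val + 1 = 1 then (1 : L) else 0)).Local v), MeasurableSpace (((UnitaryGroup.cmDatum L 2 (Matrix.of fun i j : Fin 2 => if i.val + j.val + 1 = 2 then (1 : L) else 0)).Local v × (UnitaryGroup.cmDatum L 1 (Matrix.of fun i j : Fin 1 => if i.val + j.val + 1 = 1 then (1 : L) else 0)).Local v) ⧸ Subgroup.centralizer ({a} : Set ((UnitaryGroup.cmDatum L 2 (Matrix.of fun i j : Fin 2 => if i.val + j.val + 1 = 2 then (1 : L) else 0)).Local v × (UnitaryGroup.cmDatum L 1 (Matrix.of fun i j : Fin 1 => if i.val + j.val + 1 = 1 then (1 : L) else 0)).Local v)))]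
      [∀ a : ((UnitaryGroup.cmDatum L 2 (Matrix.of fun i j : Fin 2 => if i.val + j.val + 1 = 2 then (1 : L) else 0)).Local v × (UnitaryGroup.cmDatum L 1 (Matrix.of fun i j : Fin 1 => if i.val + j.val + 1 = 1 then (1 : L) else 0)).Local v), BorelSpace (((UnitaryGroup.cmDatum L 2 (Matrix.of fun i j : Fin 2 => if i.val + j.val + 1 = 2 then (1 : L) else 0)).Local v × (UnitaryGroup.cmDatum L 1 (Matrix.of fun i j : Fin 1 => if i.val + j.val + 1 = 1 then (1 : L) else 0)).Local v) ⧸ Subgroup.centralizer ({a} : Set ((UnitaryGroup.cmDatum L 2 (Matrix.of fun i j : Fin 2 => if i.val + j.val + 1 = 2 then (1 : L) else 0)).Local v × (UnitaryGroup.cmDatum L 1 (Matrix.of fun i j : Fin 1 => if i.val + j.val + 1 = 1 then (1 : L) else 0)).Local v)))]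
      (νH : Measure ((UnitaryGroup.cmDatum L 2 (Matrix.of fun i j : Fin 2 => if i.val + j.val + 1 = 2 then (1 : L) else 0)).Local v × (UnitaryGroup.cmDatum L 1 (Matrix.of fun i j : Fin 1 => if i.val + j.val + 1 = 1 then (1 : L) else 0)).Local v)) [νH.IsHaarMeasure] [νH.IsMulRightInvariant]
      (νG₃ : Measure ((UnitaryGroup.cmDatum L 3 (Matrix.of fun i j : Fin 3 => if i.val + j.val + 1 = 3 then (1 : L) else 0)).Local v)) [νG₃.IsHaarMeasure] [νG₃.IsMulRightInvariant]
      (mH : OrbitalMeasureFamily ((UnitaryGroup.cmDatum L 2 (Matrix.of fun i j : Fin 2 => if i.val + j.val + 1 = 2 then (1 : L) else 0)).Local v × (UnitaryGroup.cmDatum L 1 (Matrix.of fun i j : Fin 1 => if i.val + j.val + 1 = 1 then (1 : L) else 0)).Local v)) (mG₃ : OrbitalMeasureFamily ((UnitaryGroup.cmDatum L 3 (Matrix.of fun i j : Fin 3 => if i.val + j.val + 1 = 3 then (1 : L) else 0)).Local v))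
      (_hmH : mH.IsCanonical (IsLocalGRegular L v) νH) (_hmG : mG₃.IsCanonical (fun γ => IsRegularElt (γ.val : GL (Fin 3) (UnitaryGroup.LocalRing L v))) νG₃)
      (C : ℂ)
      (ks bs : ℕ)
      (hAmp : ∀ (q k : ℕ) (B : ℤ), A q d tE k B = ampl q (k - ks) (B - bs))
      (hΩ : ∀ (a b : (w.1.adicCompletion L)) (n₁ n₂ n₃ : ℕ),
        a * (galAdicCompletionMap (L := L) (IsCMField.complexConj L) hw) a = 1 → b * (galAdicCompletionMap (L := L) (IsCMField.complexConj L) hw) b = 1 →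
        IsElementDatum (galAdicCompletionMap (L := L) (IsCMField.complexConj L) hw) ϖ (N₀ d) (a * a) (b * b) n₁ n₂ n₃ →
        Ω (w.1.adicCompletion L) (galAdicCompletionMap (L := L) (IsCMField.complexConj L) hw) ϖ d a b 2 = 1) :
        (∃ V ∈ 𝓝 (1 : ((UnitaryGroup.cmDatum L 2 (Matrix.of fun i j : Fin 2 => if i.val + j.val + 1 = 2 then (1 : L) else 0)).Local v × (UnitaryGroup.cmDatum L 1 (Matrix.of fun i j : Fin 1 => if i.val + j.val + 1 = 1 then (1 : L) else 0)).Local v)), ∀ γH ∈ V, IsLocalGRegular L v γH →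
          ∀ (f : Fin 4 → Fin 3 → (Fin 3 → (w.1.adicCompletion L))) (_hf : IsFourFrameFamily (galAdicCompletionMap (L := L) (IsCMField.complexConj L) hw) f)
        (a b z : (w.1.adicCompletion L)) (_ha : a * (galAdicCompletionMap (L := L) (IsCMField.complexConj L) hw) a = 1) (_hb : b * (galAdicCompletionMap (L := L) (IsCMField.complexConj L) hw) b = 1) (_hz : z * (galAdicCompletionMap (L := L) (IsCMField.complexConj L) hw) z = 1)
        (_hzγ : z = finGammaTwo L v γH w) (_hra : ((((γH).1.val : GL (Fin 2) (UnitaryGroup.LocalRing L v)).val.map (Pi.evalRingHom (fun w' : UnitaryGroup.PlacesOver L v => w'.1.adicCompletion L) w))).charpoly.IsRoot (z * (a * a))) (_hrb : ((((γH).1.val : GL (Fin 2) (UnitaryGroup.LocalRing L v)).val.map (Pi.evalRingHom (fun w' : UnitaryGroup.PlacesOver L v => w'.1.adicCompletion L) w))).charpoly.IsRoot (z * (b * b)))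
        (_ha1 : Valued.v (a - 1) < Valued.v (2 : (w.1.adicCompletion L))) (_hb1 : Valued.v (b - 1) < Valued.v (2 : (w.1.adicCompletion L)))
        (n₁ n₂ n₃ : ℕ) (_hE : IsElementDatum (galAdicCompletionMap (L := L) (IsCMField.complexConj L) hw) ϖ (N₀ d) (a * a) (b * b) n₁ n₂ n₃)
        (k : ℕ) (_hk : 2 * k + d = n₁ + n₂ + n₃ + 2)
        (Γ : Fin 4 → GL (Fin 3) (w.1.adicCompletion L)) (_hΓ : ∀ b', (Γ b' : Matrix (Fin 3) (Fin 3) (w.1.adicCompletion L)) = frameElt (galAdicCompletionMap (L := L) (IsCMField.complexConj L) hw) f b' (a * a) (b * b))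
        (tb : Fin 4 → ((UnitaryGroup.cmDatum L 3 (Matrix.of fun i j : Fin 3 => if i.val + j.val + 1 = 3 then (1 : L) else 0)).Local v)) (_htb : ∀ b', ((((localNonsplitEquiv (IsCMField.complexConj L) (Matrix.of fun i j : Fin 3 => if i.val + j.val + 1 = 3 then (1 : L) else 0) (IsCMField.complexConj_ne_one L) w hw (tb b') :
              ↥(unitaryGroupOfForm (galAdicCompletionMap (L := L) (IsCMField.complexConj L) hw) (placeForm (Matrix.of fun i j : Fin 3 => if i.val + j.val + 1 = 3 then (1 : L) else 0) w.1))) : GL (Fin 3) (w.1.adicCompletion L)) : Matrix (Fin 3) (Fin 3) (w.1.adicCompletion L))) = z • (Γ b' : Matrix (Fin 3) (Fin 3) (w.1.adicCompletion L)))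
            (i : Fin 3) (B : ℤ), 2 * B = ((![n₁, n₂, n₃] : Fin 3 → ℕ) i : ℤ) - d + 2 - 2 * shift d tE →
            (∀ t' : ((UnitaryGroup.cmDatum L 3 (Matrix.of fun i j : Fin 3 => if i.val + j.val + 1 = 3 then (1 : L) else 0)).Local v), IsLocalNormPair L (Matrix.of fun i j : Fin 3 => if i.val + j.val + 1 = 3 then (1 : L) else 0) v γH t' ↔ ∃ b', ConjClasses.mk t' = ConjClasses.mk (tb b')) →
            (∀ b' : Fin 4, ((finExplicitCollection L (Matrix.of fun i j : Fin 3 => if i.val + j.val + 1 = 3 then (1 : L) else 0) μ (finExplicitDelta_conj_left_all L (Matrix.of fun i j : Fin 3 => if i.val + j.val + 1 = 3 then (1 : L) else 0) μ) (finExplicitDelta_conj_right_all L (Matrix.of fun i j : Fin 3 => if i.val + j.val + 1 = 3 then (1 : L) else 0) μ)) v).Δ γH (tb b') = ((finExplicitCollection L (Matrix.of fun i j : Fin 3 => if i.val + j.val + 1 = 3 then (1 : L) else 0) μ (finExplicitDelta_conj_left_all L (Matrix.of fun i j : Fin 3 => if i.val + j.val + 1 = 3 then (1 : L) else 0) μ)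 (finExplicitDelta_conj_right_all L (Matrix.of fun i j : Fin 3 => if i.val + j.val + 1 = 3 then (1 : L) else 0) μ)) v).Δ γH (tb 0) * (kappaChar i b' : ℂ)) →
            ∑ s, (fun s : Fin 2 => if ((s : Fin 2) : ℕ) = d % 2 then ((C * ((2 * (Fintype.card (Valued.ResidueField (w.1.adicCompletion L)) : ℚ) ^ (-(ks : ℤ)) : ℚ) : ℂ)) + (C * ((4 * ((Fintype.card (Valued.ResidueField (w.1.adicCompletion L)) : ℚ) ^ (-(ks : ℤ)) - (Fintype.card (Valued.ResidueField (w.1.adicCompletion L)) : ℚ) ^ (shift d tE - ks + bs)) / ((Fintype.card (Valued.ResidueField (w.1.adicCompletion L)) : ℚ) - 1) : ℚ) : ℂ))) / (2 * (νH.real (Function.support (hFamily L w hw ϖ s)) : ℂ)) else -(C * ((4 * ((Fintype.card (Valued.ResidueField (w.1.adicCompletion L)) : ℚ) ^ (-(ks : ℤ)) - (Fintype.card (Valued.ResidueField (w.1.adicCompletion L)) : ℚ) ^ (shift d tE - ks + bs)) / ((Fintype.card (Valued.ResidueField (w.1.adicCompletion L)) : ℚ) - 1) : ℚ) : ℂ))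 / (2 * (νH.real (Function.support (hFamily L w hw ϖ s)) : ℂ))) s * stableOrbitalIntegralRel (IsLocalStablyConjH L v) mH (hFamily L w hw ϖ s) γH =
              C * ((((Nat.card (𝓞 ↥(maximalRealSubfield L) ⧸ v.asIdeal) : ℂ)) ^ ((n₁ + n₂) / 2)))⁻¹ * (((Ω (w.1.adicCompletion L) (galAdicCompletionMap (L := L) (IsCMField.complexConj L) hw) ϖ d a b i : ℤ) : ℂ) * ((A (Fintype.card (Valued.ResidueField (w.1.adicCompletion L))) d tE k B : ℚ) : ℂ))) :=
  hSideIdentity_hFamily_coefAffine_of_affine_token shift Ω N₀ A L w hw _he _h2 ϖ _hϖ d tE _hD δ _hδ _hδ0 μ _hμu _hμω νH νG₃ mH mG₃ _hmH _hmG C _ _ _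
    (affine_token_of_amplShift shift Ω N₀ A L w hw ϖ d tE C ks bs hAmp hΩ)

end Summit.HodgeConjecture.HodgeConjecture.Cruxes.H413.F0P3cDyRamAmplShiftAffine

end
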